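import Literature.NumberTheory.Sieve.VinogradovExpSumTools
import HarnessLib

/-!
# Elementary inequalities for the Aharonov–Regev coNP verifier: distance to `ℤ`, quadratic forms versus traces of powers

Topic `Algebra/EuclideanLattices` (family `pqc`; serves the decomposition of Aharonov–Regev 2005,
Thm. 1.1, coNP part = `gapCVP_sqrt_mem_promiseCoNP` → `Literature.Barriers.PneNP.LatticeGapCoNP`).
Everything PROVED; the only tree import is the distance-to-the-nearest-integer function
`Literature.NumberTheory.Sieve.Vinogradov.distInt` (`VinogradovExpSumTools.lean`), reused rather than
redefined.

Aharonov–Regev's verifier (§6, p. 10 of the preprint `lit read paper:doi-10-1109-focs-2004-35`)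
accepts a witness `W = (w₁, …, w_N) ⊆ L*` iff (a) `f_W(v) = N⁻¹ ∑ cos(2π⟨v, wⱼ⟩) < 1/2`, (b)
`wⱼ ∈ L*`, (c) `λ_max(W Wᵀ) ≤ 3N`; soundness (§6.1) rests on `cos x ≥ 1 - x²/2` and
`xᵀ W Wᵀ x ≤ λ_max ‖x‖²`. The tree's verifier (to be run by a Turing machine on integer data, see
the provefact notes of `LatticeGapCoNP`) is an all-integer-arithmetic VARIANT: test (a) becomes a
lower bound on `∑ⱼ ‖⟨v, wⱼ⟩‖²_{ℝ/ℤ}` (distance to the nearest integer — no cosines), and test (c)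
becomes `trace ((W Wᵀ)^k) ≤ Λ^k` for a power `k = 2^m ≥ n` (no eigenvalues). This file supplies the
elementary real inequalities that make the variant sound and complete:

* on `distInt t = |t - round t|` (tree: `distInt_le_half`, `distInt_add_int`, …): `distInt_le_abs`,
  `abs_sub_intCast_eq_distInt` (an integer within `1/2` is a nearest integer — the verifier lets the
  prover name it), `cos_two_pi_mul_eq_cos_distInt` and
  `one_sub_mul_distInt_sq_le_cos : 1 - 2π² ‖t‖²_{ℝ/ℤ} ≤ cos (2π t)` (AR's `cos x ≥ 1 - x²/2`).
* Quadratic forms over `Fin n → ℝ` (`Matrix.dotProduct`/`mulVec`): row-wise Cauchy–Schwarz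
  `‖M e‖² ≤ ‖M‖²_F ‖e‖²` (`mulVec_dotProduct_mulVec_le`), `trace (Mᵀ M) = ‖M‖²_F`, Cauchy–Schwarz for
  a positive semidefinite symmetric form (`dotProduct_mulVec_sq_le_mul`), and the **soundness of the
  trace test**: for symmetric positive semidefinite `T` and `k = 2^m`, `m ≥ 1`,
  `(eᵀ T e)^k ≤ ‖e‖^{2k} trace (T^k)` (`dotProduct_mulVec_pow_le_mul_trace`, iterated
  Cauchy–Schwarz `(eᵀTe)² ≤ ‖e‖² eᵀT²e`), whence `trace (T^k) ≤ Λ^k ⇒ eᵀ T e ≤ Λ ‖e‖²`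
  (`dotProduct_mulVec_le_of_trace_pow_le`); Gram matrices `G Gᵀ` are symmetric positive
  semidefinite with `eᵀ G Gᵀ e = ∑ⱼ ⟨e, gⱼ⟩²` (`dotProduct_mul_transpose_mulVec`).
* **Completeness of the trace test**: a quadratic-form bound `uᵀ S u ≤ λ ‖u‖²` for symmetric
  positive semidefinite `S` gives `‖S u‖² ≤ λ uᵀSu ≤ λ² ‖u‖²` (`mulVec_dotProduct_mulVec_le_of_forall`,
  Cauchy–Schwarz in the `S`-form), hence `uᵀ S^{2j} u ≤ λ^{2j} ‖u‖²` and
  `trace (S^{2j}) ≤ n λ^{2j}` (`trace_pow_le_card_mul_pow`) — all WITHOUT the spectral theorem.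

## References

* D. Aharonov, O. Regev, *Lattice problems in NP ∩ coNP*, J. ACM 52 (2005) 749–765, §6 and §6.1
  (the verifier and its soundness).
-/

noncomputable section

open Matrix Finset Literature.NumberTheory.Sieve.Vinogradov
open scoped Real

namespace Literature.Algebra.EuclideanLattices

/-! ### Distance to the nearest integer (on the tree's `Vinogradov.distInt`) -/

/-- `‖t‖_{ℝ/ℤ} ≤ |t|`. [folklore] -/
theorem distInt_le_abs (t : ℝ) : distInt t ≤ |t| := by
  simpa using distInt_le_abs_sub_int t 0

/-- `‖m + t‖_{ℝ/ℤ} = ‖t‖_{ℝ/ℤ}` for an integer `m`. [folklore] -/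
theorem distInt_int_add (m : ℤ) (t : ℝ) : distInt (m + t) = distInt t := by
  rw [add_comm, distInt_add_int]

/-- A real within `1/2` of the integer `m` has `‖t‖_{ℝ/ℤ} = |t - m|` (any integer at distance `≤ 1/2`
is a nearest integer). [folklore] -/
theorem abs_sub_intCast_eq_distInt {t : ℝ} {m : ℤ} (h : |t - m| ≤ 1 / 2) : |t - m| = distInt t := by
  refine le_antisymm ?_ (distInt_le_abs_sub_int t m)
  rw [distInt]
  rcases eq_or_ne (round t) m with hm | hm
  · rw [hm]
  · -- another integer is at distance `≥ 1/2 ≥ |t - m|`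
    have hne : (1 : ℝ) ≤ |((round t : ℤ) : ℝ) - m| := by
      rw [← Int.cast_sub, ← Int.cast_abs, ← Int.cast_one, Int.cast_le]
      exact Int.one_le_abs (sub_ne_zero.2 hm)
    have htri : |((round t : ℤ) : ℝ) - m| ≤ |t - round t| + |t - m| := by
      have := abs_sub_le ((round t : ℤ) : ℝ) t m
      rwa [abs_sub_comm ((round t : ℤ) : ℝ) t] at this
    linarith

/-- `cos (2π t) = cos (2π ‖t‖_{ℝ/ℤ})` (periodicity and evenness of `cos`). [folklore] -/
theorem cos_two_pi_mul_eq_cos_distInt (t : ℝ) : Real.cos (2 * π * t) = Real.cos (2 * π * distInt t) := by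
  rw [distInt]
  rcases abs_choice (t - round t) with h | h <;> rw [h]
  · rw [mul_sub, show 2 * π * ((round t : ℤ) : ℝ) = ((round t : ℤ) : ℝ) * (2 * π) by ring,
      Real.cos_sub_int_mul_two_pi]
  · rw [neg_sub, mul_sub, show 2 * π * ((round t : ℤ) : ℝ) = ((round t : ℤ) : ℝ) * (2 * π) by ring,
      Real.cos_int_mul_two_pi_sub]

/-- **`cos (2π t) ≥ 1 - 2π² ‖t‖²_{ℝ/ℤ}`** (`cos θ ≥ 1 - θ²/2`). [folklore] -/
theorem one_sub_mul_distInt_sq_le_cos (t : ℝ) : 1 - 2 * π ^ 2 * distInt t ^ 2 ≤ Real.cos (2 * π * t) := by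
  rw [cos_two_pi_mul_eq_cos_distInt]
  have := Real.one_sub_sq_div_two_le_cos (x := 2 * π * distInt t)
  nlinarith

/-! ### Quadratic forms, Frobenius norms and traces of powers -/

section Matrices

variable {ι κ : Type*} [Fintype ι] [Fintype κ]

/-- **Row-wise Cauchy–Schwarz**: `‖M e‖² ≤ ‖M‖²_F ‖e‖²`. [folklore] -/
theorem mulVec_dotProduct_mulVec_le (M : Matrix ι κ ℝ) (e : κ → ℝ) :
    (M *ᵥ e) ⬝ᵥ (M *ᵥ e) ≤ (∑ i, ∑ j, M i j ^ 2) * (e ⬝ᵥ e) := by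
  have key : ∀ i, (M *ᵥ e) i * (M *ᵥ e) i ≤ (∑ j, M i j ^ 2) * (e ⬝ᵥ e) := fun i ↦ by
    have h := Finset.sum_mul_sq_le_sq_mul_sq Finset.univ (fun j ↦ M i j) e
    simp only [mulVec, dotProduct, sq] at h ⊢
    exact h
  calc (M *ᵥ e) ⬝ᵥ (M *ᵥ e) = ∑ i, (M *ᵥ e) i * (M *ᵥ e) i := rfl
    _ ≤ ∑ i, (∑ j, M i j ^ 2) * (e ⬝ᵥ e) := Finset.sum_le_sum fun i _ ↦ key i
    _ = (∑ i, ∑ j, M i j ^ 2) * (e ⬝ᵥ e) := by rw [Finset.sum_mul]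

/-- `trace (Mᵀ M) = ∑ᵢⱼ Mᵢⱼ² = ‖M‖²_F`. [folklore] -/
theorem trace_transpose_mul_self_eq (M : Matrix ι κ ℝ) : trace (Mᵀ * M) = ∑ i, ∑ j, M i j ^ 2 := by
  simp only [trace, Matrix.diag_apply, Matrix.mul_apply, Matrix.transpose_apply, sq]
  exact Finset.sum_comm

/-- A symmetric matrix moves across the dot product: `(S u) ⬝ v = u ⬝ (S v)`. [folklore] -/
theorem mulVec_dotProduct_of_transpose_eq {S : Matrix ι ι ℝ} (hS : Sᵀ = S) (u v : ι → ℝ) :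
    (S *ᵥ u) ⬝ᵥ v = u ⬝ᵥ S *ᵥ v := by
  rw [dotProduct_mulVec, ← mulVec_transpose, hS]

/-- **Cauchy–Schwarz for a positive semidefinite symmetric form**: `(uᵀ S v)² ≤ (uᵀ S u)(vᵀ S v)`.
[folklore] -/
theorem dotProduct_mulVec_sq_le_mul {S : Matrix ι ι ℝ} (hS : Sᵀ = S) (hpsd : ∀ e, 0 ≤ e ⬝ᵥ S *ᵥ e)
    (u v : ι → ℝ) : (u ⬝ᵥ S *ᵥ v) ^ 2 ≤ (u ⬝ᵥ S *ᵥ u) * (v ⬝ᵥ S *ᵥ v) := by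
  -- `0 ≤ (u - t v)ᵀ S (u - t v) = vᵀSv t² - 2 uᵀSv t + uᵀSu`
  have hsym : v ⬝ᵥ S *ᵥ u = u ⬝ᵥ S *ᵥ v := by
    rw [← mulVec_dotProduct_of_transpose_eq hS, dotProduct_comm]
  have hq : ∀ t : ℝ, 0 ≤ (v ⬝ᵥ S *ᵥ v) * (t * t) + (-2 * (u ⬝ᵥ S *ᵥ v)) * t + u ⬝ᵥ S *ᵥ u := by
    intro t
    have h := hpsd (u - t • v)
    have hexp : (u - t • v) ⬝ᵥ S *ᵥ (u - t • v) =
        (v ⬝ᵥ S *ᵥ v) * (t * t) + (-2 * (u ⬝ᵥ S *ᵥ v)) * t + u ⬝ᵥ S *ᵥ u := by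
      simp only [mulVec_sub, mulVec_smul, sub_dotProduct, dotProduct_sub, dotProduct_smul, smul_dotProduct,
        smul_eq_mul, hsym]
      ring
    rwa [hexp] at h
  have hd := discrim_le_zero hq
  rw [discrim] at hd
  nlinarith

/-- **`(eᵀ T e)² ≤ ‖e‖² (eᵀ T² e)`** for symmetric `T` (Cauchy–Schwarz: `eᵀTe = ⟨e, Te⟩ ≤ ‖e‖ ‖Te‖`,
`‖Te‖² = eᵀT²e`). [folklore] -/
theorem dotProduct_mulVec_sq_le {T : Matrix ι ι ℝ} (hT : Tᵀ = T) (e : ι → ℝ) :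
    (e ⬝ᵥ T *ᵥ e) ^ 2 ≤ (e ⬝ᵥ e) * (e ⬝ᵥ (T * T) *ᵥ e) := by
  have hcs := Finset.sum_mul_sq_le_sq_mul_sq Finset.univ e (T *ᵥ e)
  have h1 : e ⬝ᵥ T *ᵥ e = ∑ i, e i * (T *ᵥ e) i := rfl
  have h2 : e ⬝ᵥ e = ∑ i, e i ^ 2 := by simp [dotProduct, sq]
  have h3 : e ⬝ᵥ (T * T) *ᵥ e = ∑ i, (T *ᵥ e) i ^ 2 := by
    rw [← mulVec_mulVec, ← mulVec_dotProduct_of_transpose_eq hT]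
    simp [dotProduct, sq]
  rw [h1, h2, h3]
  exact hcs

variable [DecidableEq ι]

/-- Powers of a symmetric matrix are symmetric. [folklore] -/
theorem transpose_pow_of_transpose_eq {T : Matrix ι ι ℝ} (hT : Tᵀ = T) (k : ℕ) : (T ^ k)ᵀ = T ^ k := by
  rw [transpose_pow, hT]

/-- Even powers of a symmetric matrix are positive semidefinite: `eᵀ T^{2j} e = ‖T^j e‖² ≥ 0`.
[folklore] -/
theorem dotProduct_pow_two_mul_mulVec_eq {T : Matrix ι ι ℝ} (hT : Tᵀ = T) (j : ℕ) (e : ι → ℝ) :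
    e ⬝ᵥ (T ^ (2 * j)) *ᵥ e = (T ^ j *ᵥ e) ⬝ᵥ (T ^ j *ᵥ e) := by
  rw [two_mul, pow_add, ← mulVec_mulVec, ← mulVec_dotProduct_of_transpose_eq (transpose_pow_of_transpose_eq hT j)]

/-- **Iterated Cauchy–Schwarz**: for symmetric positive semidefinite `T` and every `m`,
`(eᵀ T e)^{2^m} ≤ ‖e‖^{2(2^m - 1)} · eᵀ T^{2^m} e`. [folklore] -/
theorem dotProduct_mulVec_pow_two_pow_le {T : Matrix ι ι ℝ} (hT : Tᵀ = T) (hpsd : ∀ e, 0 ≤ e ⬝ᵥ T *ᵥ e)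
    (e : ι → ℝ) : ∀ m : ℕ, (e ⬝ᵥ T *ᵥ e) ^ (2 ^ m) ≤ (e ⬝ᵥ e) ^ (2 ^ m - 1) * (e ⬝ᵥ (T ^ (2 ^ m)) *ᵥ e)
  | 0 => by simp
  | m + 1 => by
    have ih := dotProduct_mulVec_pow_two_pow_le hT hpsd e m
    have hTm : (T ^ (2 ^ m))ᵀ = T ^ (2 ^ m) := transpose_pow_of_transpose_eq hT _
    -- square the induction hypothesis (both sides nonnegative) and apply Cauchy–Schwarz to `T^{2^m}`
    have h0 : 0 ≤ (e ⬝ᵥ T *ᵥ e) ^ (2 ^ m) := pow_nonneg (hpsd e) _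
    have hsq : ((e ⬝ᵥ T *ᵥ e) ^ (2 ^ m)) ^ 2 ≤ ((e ⬝ᵥ e) ^ (2 ^ m - 1) * (e ⬝ᵥ (T ^ (2 ^ m)) *ᵥ e)) ^ 2 :=
      pow_le_pow_left₀ h0 ih 2
    have hcs := dotProduct_mulVec_sq_le hTm e
    have hee : 0 ≤ e ⬝ᵥ e := by
      simp only [dotProduct, ← sq]; positivity
    have hpow : T ^ (2 ^ (m + 1)) = T ^ (2 ^ m) * T ^ (2 ^ m) := by
      rw [pow_succ, pow_mul, sq]
    have hexp : 2 ^ (m + 1) - 1 = 2 * (2 ^ m - 1) + 1 := by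
      have := Nat.one_le_two_pow (n := m)
      omega
    calc (e ⬝ᵥ T *ᵥ e) ^ 2 ^ (m + 1) = ((e ⬝ᵥ T *ᵥ e) ^ (2 ^ m)) ^ 2 := by rw [pow_succ, pow_mul]
      _ ≤ ((e ⬝ᵥ e) ^ (2 ^ m - 1) * (e ⬝ᵥ (T ^ (2 ^ m)) *ᵥ e)) ^ 2 := hsq
      _ = ((e ⬝ᵥ e) ^ (2 ^ m - 1)) ^ 2 * (e ⬝ᵥ (T ^ (2 ^ m)) *ᵥ e) ^ 2 := by ring
      _ ≤ ((e ⬝ᵥ e) ^ (2 ^ m - 1)) ^ 2 * ((e ⬝ᵥ e) * (e ⬝ᵥ (T ^ (2 ^ m) * T ^ (2 ^ m)) *ᵥ e)) := by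
          gcongr
      _ = (e ⬝ᵥ e) ^ (2 ^ (m + 1) - 1) * (e ⬝ᵥ (T ^ 2 ^ (m + 1)) *ᵥ e) := by
          rw [hexp, hpow]; ring

/-- **Quadratic form versus trace of an even power**: for symmetric `T` and every `j`,
`eᵀ T^{2j} e ≤ ‖e‖² trace (T^{2j})` (`eᵀT^{2j}e = ‖T^j e‖² ≤ ‖T^j‖²_F ‖e‖²` and
`‖T^j‖²_F = trace (T^{2j})`). [folklore] -/
theorem dotProduct_pow_two_mul_mulVec_le_trace {T : Matrix ι ι ℝ} (hT : Tᵀ = T) (j : ℕ) (e : ι → ℝ) :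
    e ⬝ᵥ (T ^ (2 * j)) *ᵥ e ≤ (e ⬝ᵥ e) * trace (T ^ (2 * j)) := by
  rw [dotProduct_pow_two_mul_mulVec_eq hT j e, mul_comm (e ⬝ᵥ e)]
  have htr : trace (T ^ (2 * j)) = ∑ i, ∑ k, (T ^ j) i k ^ 2 := by
    rw [← trace_transpose_mul_self_eq, transpose_pow_of_transpose_eq hT, two_mul, pow_add]
  rw [htr]
  exact mulVec_dotProduct_mulVec_le _ _

/-- **The trace-of-power test is sound**: for symmetric positive semidefinite `T`, `m ≥ 1` and
`k = 2^m`, `(eᵀ T e)^k ≤ ‖e‖^{2k} trace (T^k)` — hence `eᵀ T e ≤ ‖e‖² (trace T^k)^{1/k}`: the largest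
eigenvalue is controlled by the trace of a high power, WITHOUT computing eigenvalues (Aharonov–Regev
check `λ_max(W Wᵀ) ≤ 3N` by "computing the eigenvalues of this matrix", §1.1 p. 4 and §6 p. 10; this
is the elementary substitute used by the integer-arithmetic variant of the verifier).
[cite: AharonovRegev2005, §6.1 (soundness, p. 11) — variant] -/
theorem dotProduct_mulVec_pow_le_mul_trace {T : Matrix ι ι ℝ} (hT : Tᵀ = T) (hpsd : ∀ e, 0 ≤ e ⬝ᵥ T *ᵥ e)
    (e : ι → ℝ) {m : ℕ} (hm : 1 ≤ m) :
    (e ⬝ᵥ T *ᵥ e) ^ (2 ^ m) ≤ (e ⬝ᵥ e) ^ (2 ^ m) * trace (T ^ (2 ^ m)) := by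
  have h1 := dotProduct_mulVec_pow_two_pow_le hT hpsd e m
  obtain ⟨m', rfl⟩ := Nat.exists_eq_add_of_le' hm
  have h2 : e ⬝ᵥ (T ^ (2 ^ (m' + 1))) *ᵥ e ≤ (e ⬝ᵥ e) * trace (T ^ (2 ^ (m' + 1))) := by
    rw [show 2 ^ (m' + 1) = 2 * 2 ^ m' by rw [pow_succ, mul_comm]]
    exact dotProduct_pow_two_mul_mulVec_le_trace hT _ e
  have hee : 0 ≤ e ⬝ᵥ e := by
    simp only [dotProduct, ← sq]; positivity
  calc (e ⬝ᵥ T *ᵥ e) ^ (2 ^ (m' + 1))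
      ≤ (e ⬝ᵥ e) ^ (2 ^ (m' + 1) - 1) * (e ⬝ᵥ (T ^ (2 ^ (m' + 1))) *ᵥ e) := h1
    _ ≤ (e ⬝ᵥ e) ^ (2 ^ (m' + 1) - 1) * ((e ⬝ᵥ e) * trace (T ^ (2 ^ (m' + 1)))) :=
        mul_le_mul_of_nonneg_left h2 (pow_nonneg hee _)
    _ = (e ⬝ᵥ e) ^ (2 ^ (m' + 1)) * trace (T ^ (2 ^ (m' + 1))) := by
        rw [← mul_assoc, pow_sub_one_mul (pow_ne_zero _ two_ne_zero)]

/-- **Soundness of the trace test, multiplied out**: if `trace (T^k) ≤ Λ^k` for `k = 2^m`, `m ≥ 1`,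
`Λ ≥ 0`, then `eᵀ T e ≤ Λ ‖e‖²` for every `e`. [folklore] -/
theorem dotProduct_mulVec_le_of_trace_pow_le {T : Matrix ι ι ℝ} (hT : Tᵀ = T) (hpsd : ∀ e, 0 ≤ e ⬝ᵥ T *ᵥ e)
    {m : ℕ} (hm : 1 ≤ m) {Λ : ℝ} (hΛ : 0 ≤ Λ) (htr : trace (T ^ (2 ^ m)) ≤ Λ ^ (2 ^ m)) (e : ι → ℝ) :
    e ⬝ᵥ T *ᵥ e ≤ Λ * (e ⬝ᵥ e) := by
  have hee : 0 ≤ e ⬝ᵥ e := by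
    simp only [dotProduct, ← sq]; positivity
  have h := dotProduct_mulVec_pow_le_mul_trace hT hpsd e hm
  have h' : (e ⬝ᵥ T *ᵥ e) ^ (2 ^ m) ≤ (Λ * (e ⬝ᵥ e)) ^ (2 ^ m) := by
    calc (e ⬝ᵥ T *ᵥ e) ^ (2 ^ m) ≤ (e ⬝ᵥ e) ^ (2 ^ m) * trace (T ^ (2 ^ m)) := h
      _ ≤ (e ⬝ᵥ e) ^ (2 ^ m) * Λ ^ (2 ^ m) := mul_le_mul_of_nonneg_left htr (pow_nonneg hee _)
      _ = (Λ * (e ⬝ᵥ e)) ^ (2 ^ m) := by ring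
  exact le_of_pow_le_pow_left₀ (pow_ne_zero m two_ne_zero) (mul_nonneg hΛ hee) h'

/-! ### Gram matrices `T = G Gᵀ` -/

omit [DecidableEq ι] in
/-- The quadratic form of a Gram matrix is a sum of squares: `eᵀ (G Gᵀ) e = ‖Gᵀ e‖² = ∑ⱼ ⟪e, gⱼ⟫²`
(`gⱼ` the columns of `G`). [folklore] -/
theorem dotProduct_mul_transpose_mulVec (G : Matrix ι κ ℝ) (e : ι → ℝ) :
    e ⬝ᵥ (G * Gᵀ) *ᵥ e = ∑ j, (∑ i, e i * G i j) ^ 2 := by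
  rw [← mulVec_mulVec, dotProduct_mulVec, mulVec_transpose]
  simp only [dotProduct, vecMul, sq]

omit [Fintype ι] [DecidableEq ι] in
/-- A Gram matrix is symmetric. [folklore] -/
theorem transpose_mul_transpose_self (G : Matrix ι κ ℝ) : (G * Gᵀ)ᵀ = G * Gᵀ := by
  rw [transpose_mul, transpose_transpose]

omit [DecidableEq ι] in
/-- A Gram matrix is positive semidefinite. [folklore] -/
theorem dotProduct_mul_transpose_mulVec_nonneg (G : Matrix ι κ ℝ) (e : ι → ℝ) : 0 ≤ e ⬝ᵥ (G * Gᵀ) *ᵥ e := by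
  rw [dotProduct_mul_transpose_mulVec]
  positivity

/-! ### Completeness side: a quadratic-form bound controls traces of even powers -/

omit [DecidableEq ι] in
/-- **Operator bound from a quadratic-form bound**: for symmetric positive semidefinite `S` with
`uᵀ S u ≤ λ ‖u‖²` for all `u`, `‖S u‖² ≤ λ uᵀ S u ≤ λ² ‖u‖²` (Cauchy–Schwarz in the `S`-form at
`(u, S u)`). [folklore] -/
theorem mulVec_dotProduct_mulVec_le_of_forall {S : Matrix ι ι ℝ} (hS : Sᵀ = S) (hpsd : ∀ e, 0 ≤ e ⬝ᵥ S *ᵥ e)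
    {lam : ℝ} (hlam : 0 ≤ lam) (h : ∀ u, u ⬝ᵥ S *ᵥ u ≤ lam * (u ⬝ᵥ u)) (u : ι → ℝ) :
    (S *ᵥ u) ⬝ᵥ (S *ᵥ u) ≤ lam * (u ⬝ᵥ S *ᵥ u) := by
  set v := S *ᵥ u with hv
  -- `‖v‖² = uᵀ S v`
  have h1 : v ⬝ᵥ v = u ⬝ᵥ S *ᵥ v := by rw [hv, mulVec_dotProduct_of_transpose_eq hS]
  have hcs := dotProduct_mulVec_sq_le_mul hS hpsd u v
  have hvv : v ⬝ᵥ S *ᵥ v ≤ lam * (v ⬝ᵥ v) := h v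
  have h0 : 0 ≤ v ⬝ᵥ v := by simp only [dotProduct, ← sq]; positivity
  have hu0 : 0 ≤ u ⬝ᵥ S *ᵥ u := hpsd u
  -- `‖v‖⁴ ≤ (uᵀSu) (vᵀSv) ≤ (uᵀSu) λ ‖v‖²`
  rw [← h1] at hcs
  rcases h0.eq_or_lt with h00 | hpos
  · rw [← h00]; positivity
  · have : (v ⬝ᵥ v) ^ 2 ≤ (u ⬝ᵥ S *ᵥ u) * (lam * (v ⬝ᵥ v)) := hcs.trans (mul_le_mul_of_nonneg_left hvv hu0)
    nlinarith

/-- Iterating: `‖S^j u‖² ≤ λ^{2j} ‖u‖²`, i.e. `uᵀ S^{2j} u ≤ λ^{2j} ‖u‖²`. [folklore] -/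
theorem dotProduct_pow_two_mul_mulVec_le_of_forall {S : Matrix ι ι ℝ} (hS : Sᵀ = S) (hpsd : ∀ e, 0 ≤ e ⬝ᵥ S *ᵥ e)
    {lam : ℝ} (hlam : 0 ≤ lam) (h : ∀ u, u ⬝ᵥ S *ᵥ u ≤ lam * (u ⬝ᵥ u)) (u : ι → ℝ) :
    ∀ j : ℕ, u ⬝ᵥ (S ^ (2 * j)) *ᵥ u ≤ lam ^ (2 * j) * (u ⬝ᵥ u)
  | 0 => by simp
  | j + 1 => by
    have ih := dotProduct_pow_two_mul_mulVec_le_of_forall hS hpsd hlam h u j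
    rw [dotProduct_pow_two_mul_mulVec_eq hS] at ih ⊢
    -- `S^{j+1} u = S (S^j u)`
    set v := S ^ j *ᵥ u with hv
    have hstep : S ^ (j + 1) *ᵥ u = S *ᵥ v := by rw [pow_succ', ← mulVec_mulVec]
    rw [hstep]
    have h1 := mulVec_dotProduct_mulVec_le_of_forall hS hpsd hlam h v
    have h2 : v ⬝ᵥ S *ᵥ v ≤ lam * (v ⬝ᵥ v) := h v
    calc (S *ᵥ v) ⬝ᵥ (S *ᵥ v) ≤ lam * (v ⬝ᵥ S *ᵥ v) := h1
      _ ≤ lam * (lam * (v ⬝ᵥ v)) := mul_le_mul_of_nonneg_left h2 hlam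
      _ ≤ lam * (lam * (lam ^ (2 * j) * (u ⬝ᵥ u))) := by gcongr
      _ = lam ^ (2 * (j + 1)) * (u ⬝ᵥ u) := by ring

/-- **A quadratic-form bound controls traces of even powers**: for symmetric positive semidefinite
`S` on `ι` with `uᵀ S u ≤ λ ‖u‖²` for all `u`, `trace (S^{2j}) ≤ |ι| λ^{2j}` — the completeness
direction of the trace test (in print: `λ_max(W Wᵀ) ≤ 3N`, Lemma 6.3, bounds every power sum of
the eigenvalues). [cite: AharonovRegev2005, Lemma 6.3 (p. 12) — variant] -/
theorem trace_pow_le_card_mul_pow {S : Matrix ι ι ℝ} (hS : Sᵀ = S) (hpsd : ∀ e, 0 ≤ e ⬝ᵥ S *ᵥ e)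
    {lam : ℝ} (hlam : 0 ≤ lam) (h : ∀ u, u ⬝ᵥ S *ᵥ u ≤ lam * (u ⬝ᵥ u)) (j : ℕ) :
    trace (S ^ (2 * j)) ≤ Fintype.card ι * lam ^ (2 * j) := by
  have hdiag : ∀ i, (S ^ (2 * j)) i i = Pi.single i (1 : ℝ) ⬝ᵥ (S ^ (2 * j)) *ᵥ Pi.single i 1 := by
    intro i
    simp [mulVec, dotProduct, Pi.single_apply]
  calc trace (S ^ (2 * j)) = ∑ i, (S ^ (2 * j)) i i := rfl
    _ ≤ ∑ _i : ι, lam ^ (2 * j) := Finset.sum_le_sum fun i _ ↦ by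
        rw [hdiag i]
        refine (dotProduct_pow_two_mul_mulVec_le_of_forall hS hpsd hlam h _ j).trans ?_
        simp
    _ = Fintype.card ι * lam ^ (2 * j) := by simp

end Matrices

end Literature.Algebra.EuclideanLattices

end
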